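import Mathlib
import Literature.MathematicalPhysics.QuantumLattice.SchwingerOSCluster
import Literature.MathematicalPhysics.QuantumFieldTheory.OSReconstructionNoE1Proofs

/-!
# Field-vector API for `stub_coneChain_dense` (crux `PlanarSpectralCone`) — support lemmas

drefute gen 4 (refuter-drefute-stmt-QuantumFields-9664-g4-0), evidence for the lead prover. The density
argument (DrefuteSurvivedG2.md §C.4, steps 1 and 7) closes `{F | ⟪χ, Ψ_F⟫ = 0}` under sums and `𝒮`-limits of
time-ordered test functions and ends with "orthogonal to every field vector ⇒ zero". The OS file defines
`fieldVec` generator-wise (`v(δ_{(n,k,F)})`), so linearity in `F` holds only IN `ℋ` (null vectors); these are the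
missing lemmas (`fieldVec_add`, `fieldVec_smul`, `fieldVec_sub`, `norm_fieldVec_sq`, `tendsto_fieldVec`,
`inner_fieldVec_eq_zero_of_tendsto`, `eq_zero_of_forall_inner_fieldVec_eq_zero` and its one-species form).
No `def`, no notation, no `sorry`.
-/

noncomputable section

namespace DrefuteG4

open MeasureTheory Complex Set Filter Topology
open scoped InnerProductSpace ComplexConjugate SchwartzMap
open Literature.MathematicalPhysics.AQFT Literature.MathematicalPhysics.QuantumLattice
  Literature.MathematicalPhysics.QuantumFieldTheory

variable {ι : Type*} {d : ℕ} [NeZero d] {S : LabelledSchwingerFamily ι (EuclideanSpace ℝ (Fin d))}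
  (h : OSReconstructionNoE1 S)

/-- Sums of time-ordered test functions are time-ordered. -/
theorem isTimeOrdered_add {n : ℕ} {F G : 𝓢((Fin n → EuclideanSpace ℝ (Fin d)), ℂ)}
    (hF : IsTimeOrdered F) (hG : IsTimeOrdered G) : IsTimeOrdered (F + G) := by
  intro x hx
  have hx' : x ∈ tsupport (F : (Fin n → EuclideanSpace ℝ (Fin d)) → ℂ) ∪
      tsupport (G : (Fin n → EuclideanSpace ℝ (Fin d)) → ℂ) := by
    have hsub : tsupport ((F + G : 𝓢((Fin n → EuclideanSpace ℝ (Fin d)), ℂ)) :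
        (Fin n → EuclideanSpace ℝ (Fin d)) → ℂ) ⊆
        tsupport (F : (Fin n → EuclideanSpace ℝ (Fin d)) → ℂ) ∪
          tsupport (G : (Fin n → EuclideanSpace ℝ (Fin d)) → ℂ) := by
      rw [tsupport, tsupport, tsupport, ← closure_union]
      refine closure_mono ?_
      intro y hy
      by_contra hy'
      simp only [Set.mem_union, Function.mem_support, not_or, not_not] at hy'
      exact hy (by simp [hy'.1, hy'.2])
    exact hsub hx
  rcases hx' with hx' | hx'
  · exact hF hx'
  · exact hG hx'

/-- Differences of time-ordered test functions are time-ordered. -/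
theorem isTimeOrdered_sub {n : ℕ} {F G : 𝓢((Fin n → EuclideanSpace ℝ (Fin d)), ℂ)}
    (hF : IsTimeOrdered F) (hG : IsTimeOrdered G) : IsTimeOrdered (F - G) := by
  rw [sub_eq_add_neg]
  refine isTimeOrdered_add hF ?_
  have : (-G : 𝓢((Fin n → EuclideanSpace ℝ (Fin d)), ℂ)) = (-1 : ℂ) • G := by rw [neg_one_smul]
  rw [this]
  exact OSReconstructionNoE1.isTimeOrdered_smul _ hG

/-- `⟪Ψ_F, Ψ_G⟫` with the canonical tensor witness. -/
theorem inner_fieldVec_fieldVec' {n m : ℕ} (k : Fin n → ι) (k' : Fin m → ι)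
    {F : 𝓢((Fin n → EuclideanSpace ℝ (Fin d)), ℂ)} {G : 𝓢((Fin m → EuclideanSpace ℝ (Fin d)), ℂ)}
    (hF : IsTimeOrdered F) (hG : IsTimeOrdered G) :
    ⟪h.fieldVec n k F hF, h.fieldVec m k' G hG⟫_ℂ =
      S (n + m) (Fin.append (k ∘ Fin.rev) k') ((osAdjoint F).appendTensor G) :=
  h.inner_fieldVec_fieldVec k k' hF hG (isAppendTensorOf_appendTensor _ _)

/-- **`Ψ_{F+G} = Ψ_F + Ψ_G`** in `ℋ` (the difference is a null vector of the OS form). -/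
theorem fieldVec_add {n : ℕ} (k : Fin n → ι) {F G : 𝓢((Fin n → EuclideanSpace ℝ (Fin d)), ℂ)}
    (hF : IsTimeOrdered F) (hG : IsTimeOrdered G) (hFG : IsTimeOrdered (F + G)) :
    h.fieldVec n k (F + G) hFG = h.fieldVec n k F hF + h.fieldVec n k G hG := by
  rw [← sub_eq_zero, ← inner_self_eq_zero (𝕜 := ℂ)]
  simp only [inner_sub_left, inner_sub_right, inner_add_left, inner_add_right,
    inner_fieldVec_fieldVec', osAdjoint_add, SchwartzMap.appendTensor_add_left,
    SchwartzMap.appendTensor_add_right, map_add]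
  ring

/-- **`Ψ_{cF} = c Ψ_F`** in `ℋ`. -/
theorem fieldVec_smul {n : ℕ} (k : Fin n → ι) (c : ℂ) {F : 𝓢((Fin n → EuclideanSpace ℝ (Fin d)), ℂ)}
    (hF : IsTimeOrdered F) (hcF : IsTimeOrdered (c • F)) :
    h.fieldVec n k (c • F) hcF = c • h.fieldVec n k F hF := by
  rw [← sub_eq_zero, ← inner_self_eq_zero (𝕜 := ℂ)]
  simp only [inner_sub_left, inner_sub_right, inner_smul_left, inner_smul_right,
    inner_fieldVec_fieldVec', osAdjoint_smul, SchwartzMap.appendTensor_smul_left,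
    SchwartzMap.appendTensor_smul_right, map_smul, smul_eq_mul]
  ring

/-- **`Ψ_{F−G} = Ψ_F − Ψ_G`** in `ℋ`. -/
theorem fieldVec_sub {n : ℕ} (k : Fin n → ι) {F G : 𝓢((Fin n → EuclideanSpace ℝ (Fin d)), ℂ)}
    (hF : IsTimeOrdered F) (hG : IsTimeOrdered G) (hFG : IsTimeOrdered (F - G)) :
    h.fieldVec n k (F - G) hFG = h.fieldVec n k F hF - h.fieldVec n k G hG := by
  rw [← sub_eq_zero, ← inner_self_eq_zero (𝕜 := ℂ)]
  simp only [inner_sub_left, inner_sub_right, inner_fieldVec_fieldVec', map_sub,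
    show osAdjoint (F - G) = osAdjoint F - osAdjoint G by
      rw [sub_eq_add_neg, osAdjoint_add, ← neg_one_smul ℂ G, osAdjoint_smul]; simp [sub_eq_add_neg],
    SchwartzMap.appendTensor_sub_left, SchwartzMap.appendTensor_sub_right]
  ring

/-- **`‖Ψ_F‖² = Re 𝔖(ΘF* ⊗ F)`.** -/
theorem norm_fieldVec_sq {n : ℕ} (k : Fin n → ι) {F : 𝓢((Fin n → EuclideanSpace ℝ (Fin d)), ℂ)}
    (hF : IsTimeOrdered F) :
    ‖h.fieldVec n k F hF‖ ^ 2 = (S (n + n) (Fin.append (k ∘ Fin.rev) k) ((osAdjoint F).appendTensor F)).re := by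
  rw [← inner_fieldVec_fieldVec' h k k hF hF, ← inner_self_eq_norm_sq (𝕜 := ℂ)]
  rfl

/-- **Continuity of `F ↦ Ψ_F` along time-ordered families**: if `F a → G` in `𝒮` then `Ψ_{F a} → Ψ_G`. -/
theorem tendsto_fieldVec {α : Type*} {l : Filter α} {n : ℕ} (k : Fin n → ι)
    {F : α → 𝓢((Fin n → EuclideanSpace ℝ (Fin d)), ℂ)} (hF : ∀ a, IsTimeOrdered (F a))
    {G : 𝓢((Fin n → EuclideanSpace ℝ (Fin d)), ℂ)} (hG : IsTimeOrdered G)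
    (hlim : Tendsto F l (𝓝 G)) :
    Tendsto (fun a => h.fieldVec n k (F a) (hF a)) l (𝓝 (h.fieldVec n k G hG)) := by
  rw [tendsto_iff_norm_sub_tendsto_zero]
  -- the quadratic form `A ↦ 𝔖(ΘA* ⊗ A)` is continuous on `𝒮` and vanishes at `0`
  have hq : Continuous fun A : 𝓢((Fin n → EuclideanSpace ℝ (Fin d)), ℂ) =>
      (S (n + n) (Fin.append (k ∘ Fin.rev) k) ((osAdjoint A).appendTensor A)).re :=
    Complex.continuous_re.comp ((S (n + n) (Fin.append (k ∘ Fin.rev) k)).continuous.comp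
      (continuous_appendTensor.comp (continuous_osAdjoint.prodMk continuous_id)))
  have h0 : Tendsto (fun a => F a - G) l (𝓝 0) := by
    have := hlim.sub (tendsto_const_nhds (x := G))
    rwa [sub_self] at this
  have h1 : Tendsto (fun a => (S (n + n) (Fin.append (k ∘ Fin.rev) k)
      ((osAdjoint (F a - G)).appendTensor (F a - G))).re) l (𝓝 0) := by
    have := (hq.tendsto 0).comp h0
    have hz : (S (n + n) (Fin.append (k ∘ Fin.rev) k)
        ((osAdjoint (0 : 𝓢((Fin n → EuclideanSpace ℝ (Fin d)), ℂ))).appendTensor 0)).re = 0 := by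
      have : ((osAdjoint (0 : 𝓢((Fin n → EuclideanSpace ℝ (Fin d)), ℂ))).appendTensor
          (0 : 𝓢((Fin n → EuclideanSpace ℝ (Fin d)), ℂ))) = 0 := by
        ext x; simp
      rw [this, map_zero, Complex.zero_re]
    simpa [Function.comp_def, hz] using this
  have h2 : ∀ a, ‖h.fieldVec n k (F a) (hF a) - h.fieldVec n k G hG‖ =
      Real.sqrt ((S (n + n) (Fin.append (k ∘ Fin.rev) k)
        ((osAdjoint (F a - G)).appendTensor (F a - G))).re) := by
    intro a
    rw [← fieldVec_sub h k (hF a) hG (isTimeOrdered_sub (hF a) hG), ← norm_fieldVec_sq,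
      Real.sqrt_sq (norm_nonneg _)]
  simp_rw [h2]
  have := h1.sqrt
  rwa [Real.sqrt_zero] at this

/-- Orthogonality passes to `𝒮`-limits of time-ordered test functions. -/
theorem inner_fieldVec_eq_zero_of_tendsto {α : Type*} {l : Filter α} [l.NeBot] {n : ℕ} (k : Fin n → ι)
    (χ : h.Hilbert) {F : α → 𝓢((Fin n → EuclideanSpace ℝ (Fin d)), ℂ)} (hF : ∀ a, IsTimeOrdered (F a))
    {G : 𝓢((Fin n → EuclideanSpace ℝ (Fin d)), ℂ)} (hG : IsTimeOrdered G) (hlim : Tendsto F l (𝓝 G))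
    (hχ : ∀ a, ⟪χ, h.fieldVec n k (F a) (hF a)⟫_ℂ = 0) :
    ⟪χ, h.fieldVec n k G hG⟫_ℂ = 0 := by
  have ht : Tendsto (fun a => ⟪χ, h.fieldVec n k (F a) (hF a)⟫_ℂ) l (𝓝 ⟪χ, h.fieldVec n k G hG⟫_ℂ) :=
    (tendsto_const_nhds (x := χ)).inner (tendsto_fieldVec h k hF hG hlim)
  have h0 : Tendsto (fun a => ⟪χ, h.fieldVec n k (F a) (hF a)⟫_ℂ) l (𝓝 0) := by
    simp only [hχ]; exact tendsto_const_nhds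
  exact tendsto_nhds_unique ht h0

/-- **A vector orthogonal to every field vector is zero** (all arities, all label strings). -/
theorem eq_zero_of_forall_inner_fieldVec_eq_zero (χ : h.Hilbert)
    (hχ : ∀ (n : ℕ) (k : Fin n → ι) (F : 𝓢((Fin n → EuclideanSpace ℝ (Fin d)), ℂ)) (hF : IsTimeOrdered F),
      ⟪χ, h.fieldVec n k F hF⟫_ℂ = 0) :
    χ = 0 := by
  have hall : ∀ x : h.Hilbert, ⟪χ, x⟫_ℂ = 0 := by
    intro x
    refine h.denseRange_vec.induction_on x (isClosed_eq (continuous_const.inner continuous_id)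
      continuous_const) fun v => ?_
    rw [h.vec_eq_sum_genVec, Finsupp.sum, inner_sum]
    refine Finset.sum_eq_zero fun p _ => ?_
    rw [inner_smul_right]
    obtain ⟨n, k, F, hF⟩ := p
    have : h.genVec ⟨n, k, F, hF⟩ = h.fieldVec n k F hF := (h.fieldVec_eq_genVec n k F hF).symm
    rw [this, hχ n k F hF, mul_zero]
  exact inner_self_eq_zero.1 (hall χ)

/-- One-species form (labels in `Unit`, as in `stub_coneChain_dense`): a vector orthogonal to
`Ψ_F = h.fieldVec n (fun _ => ()) F hF` for every time-ordered `F` of every arity is zero. -/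
theorem eq_zero_of_forall_inner_fieldVec_eq_zero_unit {d : ℕ} [NeZero d]
    {S : LabelledSchwingerFamily Unit (EuclideanSpace ℝ (Fin d))} (h : OSReconstructionNoE1 S) (χ : h.Hilbert)
    (hχ : ∀ (n : ℕ) (F : 𝓢((Fin n → EuclideanSpace ℝ (Fin d)), ℂ)) (hF : IsTimeOrdered F),
      ⟪χ, h.fieldVec n (fun _ => ()) F hF⟫_ℂ = 0) :
    χ = 0 :=
  eq_zero_of_forall_inner_fieldVec_eq_zero h χ fun n k F hF => by
    have hk : k = fun _ => () := funext fun _ => rfl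
    subst hk
    exact hχ n F hF

end DrefuteG4
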